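import Summits.RiemannHypothesis.RiemannHypothesis.Theorems.JensenLogBandCanaryCheck

/-!
# E-CANARY-128 — D3 file 7/8: soundness of the checkers (`checkPiece = true → PieceIneq`, `checkAxis = true → AxisIneq`)

RH-FREE. The arithmetic half of the contract of `…CanaryDefs`: under the enclosure hypothesis
`RatioEncloses box xiTaylorCoeffFrom128` (certified numerics, quoted by name) and `nmax < box.length`, a `true`
answer of `checkPiece box nmax (rbArr box nmax) a b L d K N J xbar U V` implies `PieceIneq a b L d K N J xbar`, and
a `true` answer of `checkAxis box nmax (rbArr box nmax) a d N xbar U` implies `AxisIneq a d N xbar`. Every step is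
an inclusion lemma of `…CanaryArith/Series/Check` plus positivity of `γ` (`xiTaylorCoeff_pos_holds`); no analysis.
Nothing here bears on the truth of RH.
-/

-- D-0017: the doubled namespace is by design.
set_option linter.dupNamespace false
set_option autoImplicit false

namespace Summit.RiemannHypothesis.RiemannHypothesis.Theorems.JensenPolynomials.LogBand.Canary

open Summit.RiemannHypothesis.RiemannHypothesis.Theorems.JensenPolynomials.CoeffTable (Iv lk RatioEncloses)
open Complex
open scoped Nat

/-! ## Small helpers -/

/-- `dy (c·m) e = c · dy m e`. -/
theorem dy_const_mul (c m e : ℤ) : dy (c * m) e = (c : ℝ) * dy m e := by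
  unfold dy; push_cast; ring

/-- Strict monotonicity in the mantissa. -/
theorem dy_strictMono {m m' : ℤ} (e : ℤ) (h : m < m') : dy m e < dy m' e := by
  unfold dy
  exact mul_lt_mul_of_pos_right (by exact_mod_cast h) (zpow_pos (by norm_num) e)

/-- `dy` of a finite sum. -/
theorem dy_sum (s : Finset ℕ) (f : ℕ → ℤ) (e : ℤ) : dy (∑ j ∈ s, f j) e = ∑ j ∈ s, dy (f j) e := by
  unfold dy; push_cast; rw [Finset.sum_mul]

/-- From the integer ceiling division: `dy m U · (P / Q) ≤ dy ⌈m·P/Q⌉ U` (`Q > 0`, `P ≥ 0`). -/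
theorem dy_mul_div_le_divCeil (m : ℤ) (P : ℕ) {Q : ℕ} (hQ : 0 < Q) (U : ℤ) :
    dy m U * ((P : ℝ) / (Q : ℝ)) ≤ dy (divCeil (m * (P : ℤ)) Q) U := by
  have hz := le_divCeil_mul (m * (P : ℤ)) hQ
  have hQr : (0 : ℝ) < (Q : ℝ) := by exact_mod_cast hQ
  have h1 : dy (m * (P : ℤ)) U ≤ dy (divCeil (m * (P : ℤ)) Q * (Q : ℤ)) U := dy_mono U hz
  rw [← dy_mul_int, ← dy_mul_int] at h1
  have : dy m U * ((P : ℝ) / (Q : ℝ)) * (Q : ℝ) ≤ dy (divCeil (m * (P : ℤ)) Q) U * (Q : ℝ) := by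
    calc dy m U * ((P : ℝ) / (Q : ℝ)) * (Q : ℝ) = dy m U * ((P : ℤ) : ℝ) := by push_cast; field_simp
      _ ≤ dy (divCeil (m * (P : ℤ)) Q) U * ((Q : ℤ) : ℝ) := h1
      _ = dy (divCeil (m * (P : ℤ)) Q) U * (Q : ℝ) := by push_cast; ring
  exact le_of_mul_le_mul_right this hQr

/-- A geometric tail with ratio `≤ 1/2`: `A/(1−q) ≤ 2·B` when `0 ≤ A ≤ B` and `q ≤ 1/2`. -/
theorem div_one_sub_le_two_mul {A B q : ℝ} (hA : 0 ≤ A) (hAB : A ≤ B) (hq : q ≤ 1 / 2) : A / (1 - q) ≤ 2 * B := by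
  have h1 : (0 : ℝ) < 1 - q := by linarith
  rw [div_le_iff₀ h1]
  nlinarith

/-- Real part of a sum of real multiples of real numbers (cast to `ℂ`). -/
theorem re_sum_ofReal_mul (s : Finset ℕ) (r t : ℕ → ℝ) :
    (∑ k ∈ s, (r k : ℂ) * ((t k : ℝ) : ℂ)).re = ∑ k ∈ s, r k * t k := by
  rw [Complex.re_sum]
  refine Finset.sum_congr rfl fun k _ => ?_
  simp [Complex.mul_re]

/-! ## The piece checker is sound -/

/-- **Soundness of `checkPiece`.** -/
theorem pieceIneq_of_checkPiece {box : List Iv} {nmax : ℕ} (hbox : RatioEncloses box xiTaylorCoeffFrom128)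
    (hlen : nmax < box.length) {a b : ℤ} {L d K N J xbar : ℕ} {U V : ℤ}
    (h : checkPiece box nmax (rbArr box nmax) a b L d K N J xbar U V = true) :
    PieceIneq a b L d K N J xbar := by
  simp only [checkPiece, Bool.and_eq_true, decide_eq_true_eq] at h
  obtain ⟨⟨⟨⟨⟨⟨⟨hKN, hNn⟩, hKJn⟩, hd⟩, hab⟩, hq⟩, hq'⟩, hmain⟩ := h
  -- abbreviations
  set rb := rbArr box nmax with hrb
  set pz := pzArr a b N with hpzdef
  set px := pzArr (2 * (xbar : ℤ)) 0 (N + 1) with hpxdef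
  set ph := pzArr (L : ℤ) 0 (K + J + 1) with hphdef
  set zc := pieceCentre a b with hzc
  have hγ : ∀ n, 0 < xiTaylorCoeffFrom128 n := xiTaylorCoeffFrom128_pos
  -- enclosures of r_n
  have hr : ∀ m, m ≤ nmax → FI.Mem (canaryR m) (getFI rb m) ∧ 0 ≤ (getFI rb m).lo := fun m hm => by
    rw [canaryR_eq]; exact rbArr_mem hbox hγ hlen.le hm
  -- enclosures of z_c^k/k!, xbar^k/k!, h^k/k!
  have hpz : ∀ m, m ≤ N → CI.Mem (zc ^ m / (m ! : ℂ)) (getCI pz m) := fun m hm => pzArr_mem a b hm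
  have hx2 : (((2 * (xbar : ℤ) : ℤ)) : ℝ) / 2 = (xbar : ℝ) := by push_cast; ring
  have hpx : ∀ m, m ≤ N + 1 → CI.Mem ((((xbar : ℝ) ^ m / (m ! : ℝ) : ℝ) : ℂ)) (getCI px m) := by
    intro m hm
    have := pzArr_mem (2 * (xbar : ℤ)) 0 hm
    rwa [pieceCentre_real_pow_div, hx2] at this
  have hL2 : (((L : ℤ) : ℝ)) / 2 = (L : ℝ) / 2 := by push_cast; ring
  have hph : ∀ m, m ≤ K + J + 1 → CI.Mem (((((L : ℝ) / 2) ^ m / (m ! : ℝ) : ℝ) : ℂ)) (getCI ph m) := by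
    intro m hm
    have := pzArr_mem (L : ℤ) 0 hm
    rwa [pieceCentre_real_pow_div, hL2] at this
  -- the partial sums S_j
  have hS : ∀ j, j ≤ K → BoxAt U (canaryS j N zc) (sumS rb pz j N U) := by
    intro j hj
    rw [canaryS_eq]
    exact sumS_mem (r := canaryR) (p := fun k => zc ^ k / (k ! : ℂ)) (fun m hm => hr m (by omega))
      (fun m hm => hpz m (by omega)) (by omega)
  -- margin and moduli
  have hM : dy (marginOf (sumS rb pz 0 N U) d) U ≤ (canaryS 0 N zc / I ^ d).re := dy_marginOf_le (hS 0 (by omega)) hd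
  have hSj : ∀ j, j ≤ K → ‖canaryS j N zc‖ ≤ dy (absUB (sumS rb pz j N U)) U := fun j hj => norm_le_dy_absUB (hS j hj)
  -- the ratio tests
  have hρN : FI.Mem (canaryRho (129 + N)) (rhoFI (lk box (N + 1))) := by
    have := rhoFI_mem hbox hγ (i := N + 1) (by omega)
    rw [show 129 + N = 128 + (N + 1) by omega, canaryRho_eq]; exact this
  have hρKJ : FI.Mem (canaryRho (129 + K + J)) (rhoFI (lk box (K + J + 1))) := by
    have := rhoFI_mem hbox hγ (i := K + J + 1) (by omega)
    rw [show 129 + K + J = 128 + (K + J + 1) by omega, canaryRho_eq]; exact this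
  have hqK := le_of_qHalfOK hq hρN      -- ρ · (2 xbar) ≤ N - K + 2
  have hqKJ := le_of_qHalfOK hq' hρKJ   -- ρ' · L ≤ K + J + 2
  have hq_le : ∀ j, j ≤ K → canaryTruncQ j N xbar ≤ 1 / 2 := by
    intro j hj
    unfold canaryTruncQ
    have hden : (0 : ℝ) < ((N - j + 2 : ℕ) : ℝ) := by positivity
    rw [div_le_iff₀ hden]
    have h1 : ((N - K + 2 : ℕ) : ℝ) ≤ ((N - j + 2 : ℕ) : ℝ) := by exact_mod_cast (by omega : N - K + 2 ≤ N - j + 2)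
    have h2 : canaryRho (129 + N) * (xbar : ℝ) * 2 ≤ ((N - K + 2 : ℕ) : ℝ) := by
      have e : ((2 * xbar : ℕ) : ℝ) = 2 * (xbar : ℝ) := by push_cast; ring
      rw [e] at hqK; linarith
    linarith
  have hq'_le : canaryTaylorQ K J ((L : ℝ) / 2) ≤ 1 / 2 := by
    unfold canaryTaylorQ
    have hden : (0 : ℝ) < ((K + J + 2 : ℕ) : ℝ) := by positivity
    rw [div_le_iff₀ hden]
    have := hqKJ; push_cast at this ⊢; linarith
  -- truncation allowances TR_j ≤ 2·⌈r_{N+1} xbar^{N-j+1}/(N-j+1)!⌉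
  have hTR : ∀ j, j ≤ K →
      canaryTrunc j N xbar ≤ dy (2 * prodUB (getFI rb (N + 1)) (getCI px (N - j + 1)) U) U := by
    intro j hj
    have hB := le_dy_prodUB (hr (N + 1) hNn).2 (hr (N + 1) hNn).1 (hpx (N - j + 1) (by omega)) U
    simp only [Complex.ofReal_re] at hB
    have hA0 : 0 ≤ canaryR (N + 1) * ((xbar : ℝ) ^ (N - j + 1) / ((N - j + 1) ! : ℝ)) := by
      have := canaryR_nonneg (N + 1); positivity
    unfold canaryTrunc
    rw [dy_const_mul, show canaryR (N + 1) * (xbar : ℝ) ^ (N - j + 1) / ((N - j + 1) ! : ℝ)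
        = canaryR (N + 1) * ((xbar : ℝ) ^ (N - j + 1) / ((N - j + 1) ! : ℝ)) by ring]
    push_cast
    exact div_one_sub_le_two_mul hA0 hB (hq_le j hj)
  -- Taylor allowance ≤ dy TT V
  have hTT : canaryTaylorTail K J ((L : ℝ) / 2) ≤
      dy ((sumSAux rb ph 0 V J (K + 1) 0 0 0 0).2.1 + 2 * prodUB (getFI rb (K + J + 1)) (getCI ph (K + J + 1)) V) V := by
    rw [dy_add]
    unfold canaryTaylorTail
    apply add_le_add
    · -- the partial sum Σ_{j=K+1}^{K+J}
      have h0 : BoxAt V (0 : ℂ) (0, 0, 0, 0) := by simp [BoxAt]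
      have hsum := sumSAux_mem (U := V) (j := 0) (K₀ := K + J + 1) (r := canaryR)
        (p := fun m => (((((L : ℝ) / 2) ^ m / (m ! : ℝ) : ℝ) : ℂ)))
        (fun m hm => hr m (by omega)) (fun m hm => hph m (by omega)) J (K + 1) 0 0 0 0 0 (by omega) h0
      rw [zero_add] at hsum
      have hre := hsum.2.1
      simp only [Nat.add_zero] at hre
      rw [re_sum_ofReal_mul] at hre
      rw [Finset.sum_Ico_eq_sum_range, show K + J + 1 - (K + 1) = J by omega]
      refine le_trans (le_of_eq ?_) hre
      refine Finset.sum_congr rfl fun i _ => ?_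
      ring
    · -- the geometric remainder
      have hB := le_dy_prodUB (hr (K + J + 1) hKJn).2 (hr (K + J + 1) hKJn).1 (hph (K + J + 1) le_rfl) V
      simp only [Complex.ofReal_re] at hB
      have hA0 : 0 ≤ canaryR (K + J + 1) * (((L : ℝ) / 2) ^ (K + J + 1) / ((K + J + 1) ! : ℝ)) := by
        have := canaryR_nonneg (K + J + 1); positivity
      rw [dy_const_mul, show canaryR (K + J + 1) * ((L : ℝ) / 2) ^ (K + J + 1) / ((K + J + 1) ! : ℝ)
          = canaryR (K + J + 1) * (((L : ℝ) / 2) ^ (K + J + 1) / ((K + J + 1) ! : ℝ)) by ring]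
      push_cast
      exact div_one_sub_le_two_mul hA0 hB hq'_le
  -- the majorant: canaryFmaj N xbar + TR_0 ≤ dy Fx U
  have hF : canaryFmaj N xbar ≤ dy (sumS rb px 0 N U).2.1 U := by
    have hsum := sumS_mem (U := U) (j := 0) (N := N) (r := canaryR) (p := fun m => ((((xbar : ℝ) ^ m / (m ! : ℝ) : ℝ) : ℂ)))
      (fun m hm => hr m (by omega)) (fun m hm => hpx m (by omega)) (by omega)
    have hre := hsum.2.1
    simp only [Nat.add_zero, Nat.sub_zero] at hre
    rw [re_sum_ofReal_mul] at hre
    unfold canaryFmaj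
    refine le_trans (le_of_eq ?_) hre
    refine Finset.sum_congr rfl fun i _ => ?_
    ring
  have hTR0 := hTR 0 (Nat.zero_le K)
  simp only [Nat.sub_zero] at hTR0
  -- nonnegativity of the real factors
  have hF0 : 0 ≤ canaryFmaj N xbar + canaryTrunc 0 N xbar := by
    have h1 : 0 ≤ canaryFmaj N xbar := by
      unfold canaryFmaj
      exact Finset.sum_nonneg fun k _ => by have := canaryR_nonneg k; positivity
    have h2 : 0 ≤ canaryTrunc 0 N xbar := by
      unfold canaryTrunc
      have := canaryR_nonneg (N + 1)
      have hq0 := hq_le 0 (Nat.zero_le K)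
      have : 0 < 1 - canaryTruncQ 0 N xbar := by linarith
      positivity
    linarith
  have hT0 : 0 ≤ canaryTaylorTail K J ((L : ℝ) / 2) := by
    unfold canaryTaylorTail
    have h1 : 0 ≤ ∑ j ∈ Finset.Ico (K + 1) (K + J + 1), canaryR j * ((L : ℝ) / 2) ^ j / (j ! : ℝ) :=
      Finset.sum_nonneg fun k _ => by have := canaryR_nonneg k; positivity
    have h2 : 0 ≤ canaryR (K + J + 1) * ((L : ℝ) / 2) ^ (K + J + 1) / ((K + J + 1) ! : ℝ) /
        (1 - canaryTaylorQ K J ((L : ℝ) / 2)) := by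
      have := canaryR_nonneg (K + J + 1)
      have : 0 < 1 - canaryTaylorQ K J ((L : ℝ) / 2) := by linarith
      positivity
    linarith
  -- the product term
  set Fx := (sumS rb px 0 N U).2.1 + 2 * prodUB (getFI rb (N + 1)) (getCI px (N + 1)) U with hFx
  set TT := (sumSAux rb ph 0 V J (K + 1) 0 0 0 0).2.1 + 2 * prodUB (getFI rb (K + J + 1)) (getCI ph (K + J + 1)) V
    with hTTdef
  have hFx' : canaryFmaj N xbar + canaryTrunc 0 N xbar ≤ dy Fx U := by rw [hFx, dy_add]; exact add_le_add hF hTR0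
  have hprod : (canaryFmaj N xbar + canaryTrunc 0 N xbar) * canaryTaylorTail K J ((L : ℝ) / 2)
      ≤ dy (toUnitCeil (Fx * TT) (U + V) U) U := by
    calc (canaryFmaj N xbar + canaryTrunc 0 N xbar) * canaryTaylorTail K J ((L : ℝ) / 2)
        ≤ dy Fx U * dy TT V := mul_le_mul hFx' hTT hT0 (hF0.trans hFx')
      _ = dy (Fx * TT) (U + V) := dy_mul _ _ _ _
      _ ≤ dy (toUnitCeil (Fx * TT) (U + V) U) U := dy_le_toUnitCeil _ _ _
  -- the deviation terms
  have hdev : ∀ j ∈ Finset.Icc 1 K,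
      (‖canaryS j N zc‖ + canaryTrunc j N xbar) * ((L : ℝ) / 2) ^ j / (j ! : ℝ) ≤ dy (devTerm rb pz px N L U j) U := by
    intro j hj
    rw [Finset.mem_Icc] at hj
    have hm : ‖canaryS j N zc‖ + canaryTrunc j N xbar ≤
        dy (absUB (sumS rb pz j N U) + 2 * prodUB (getFI rb (N + 1)) (getCI px (N - j + 1)) U) U := by
      rw [dy_add]; exact add_le_add (hSj j hj.2) (hTR j hj.2)
    have hfac : ((L : ℝ) / 2) ^ j / (j ! : ℝ) = ((L ^ j : ℕ) : ℝ) / ((2 ^ j * j ! : ℕ) : ℝ) := by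
      push_cast; rw [div_pow]; ring
    unfold devTerm
    calc (‖canaryS j N zc‖ + canaryTrunc j N xbar) * ((L : ℝ) / 2) ^ j / (j ! : ℝ)
        = (‖canaryS j N zc‖ + canaryTrunc j N xbar) * (((L : ℝ) / 2) ^ j / (j ! : ℝ)) := by ring
      _ ≤ dy (absUB (sumS rb pz j N U) + 2 * prodUB (getFI rb (N + 1)) (getCI px (N - j + 1)) U) U *
            (((L : ℝ) / 2) ^ j / (j ! : ℝ)) := mul_le_mul_of_nonneg_right hm (by positivity)
      _ ≤ _ := by rw [hfac]; exact dy_mul_div_le_divCeil _ _ (by positivity) U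
  have hdevsum : (∑ j ∈ Finset.Icc 1 K, (‖canaryS j N zc‖ + canaryTrunc j N xbar) * ((L : ℝ) / 2) ^ j / (j ! : ℝ))
      ≤ dy (∑ j ∈ Finset.Icc 1 K, devTerm rb pz px N L U j) U := by
    rw [dy_sum]; exact Finset.sum_le_sum hdev
  -- assemble
  have hint : dy ((∑ j ∈ Finset.Icc 1 K, devTerm rb pz px N L U j) + toUnitCeil (Fx * TT) (U + V) U) U <
      dy (marginOf (sumS rb pz 0 N U) d - 2 * prodUB (getFI rb (N + 1)) (getCI px (N + 1)) U) U :=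
    dy_strictMono U hmain
  rw [dy_add, show marginOf (sumS rb pz 0 N U) d - 2 * prodUB (getFI rb (N + 1)) (getCI px (N + 1)) U
      = marginOf (sumS rb pz 0 N U) d + (-(2 * prodUB (getFI rb (N + 1)) (getCI px (N + 1)) U)) by ring,
    dy_add, dy_neg] at hint
  unfold PieceIneq
  dsimp only
  refine ⟨hKN, norm_pieceCentre_le hab, lt_of_le_of_lt (hq_le K le_rfl) (by norm_num),
    lt_of_le_of_lt hq'_le (by norm_num), ?_⟩
  linarith [hdevsum, hprod, hM, hTR0]

/-! ## The axis checker is sound -/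

/-- **Soundness of `checkAxis`.** -/
theorem axisIneq_of_checkAxis {box : List Iv} {nmax : ℕ} (hbox : RatioEncloses box xiTaylorCoeffFrom128)
    (hlen : nmax < box.length) {a : ℤ} {d N xbar : ℕ} {U : ℤ}
    (h : checkAxis box nmax (rbArr box nmax) a d N xbar U = true) : AxisIneq a d N xbar := by
  simp only [checkAxis, Bool.and_eq_true, decide_eq_true_eq] at h
  obtain ⟨⟨⟨⟨⟨hN1, hNn⟩, hd⟩, hab⟩, hq⟩, hmain⟩ := h
  set rb := rbArr box nmax with hrb
  set pz := pzArr a 0 N with hpzdef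
  set px := pzArr (2 * (xbar : ℤ)) 0 (N + 1) with hpxdef
  have hγ : ∀ n, 0 < xiTaylorCoeffFrom128 n := xiTaylorCoeffFrom128_pos
  have hr : ∀ m, m ≤ nmax → FI.Mem (canaryR m) (getFI rb m) ∧ 0 ≤ (getFI rb m).lo := fun m hm => by
    rw [canaryR_eq]; exact rbArr_mem hbox hγ hlen.le hm
  have hpz : ∀ m, m ≤ N → CI.Mem (pieceCentre a 0 ^ m / (m ! : ℂ)) (getCI pz m) := fun m hm => pzArr_mem a 0 hm
  have hx2 : (((2 * (xbar : ℤ) : ℤ)) : ℝ) / 2 = (xbar : ℝ) := by push_cast; ring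
  have hpx : ∀ m, m ≤ N + 1 → CI.Mem ((((xbar : ℝ) ^ m / (m ! : ℝ) : ℝ) : ℂ)) (getCI px m) := by
    intro m hm
    have := pzArr_mem (2 * (xbar : ℤ)) 0 hm
    rwa [pieceCentre_real_pow_div, hx2] at this
  have hS : BoxAt U (canaryS 0 N (pieceCentre a 0)) (sumS rb pz 0 N U) := by
    rw [canaryS_eq]
    exact sumS_mem (r := canaryR) (p := fun k => pieceCentre a 0 ^ k / (k ! : ℂ)) (fun m hm => hr m (by omega))
      (fun m hm => hpz m (by omega)) (by omega)
  have hM : dy (marginOf (sumS rb pz 0 N U) d) U ≤ (canaryS 0 N (pieceCentre a 0) / I ^ d).re := dy_marginOf_le hS hd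
  have hρN : FI.Mem (canaryRho (129 + N)) (rhoFI (lk box (N + 1))) := by
    have := rhoFI_mem hbox hγ (i := N + 1) (by omega)
    rw [show 129 + N = 128 + (N + 1) by omega, canaryRho_eq]; exact this
  have hqK := le_of_qHalfOK hq hρN
  have hq_le : canaryTruncQ 0 N xbar ≤ 1 / 2 := by
    unfold canaryTruncQ
    have hden : (0 : ℝ) < ((N - 0 + 2 : ℕ) : ℝ) := by positivity
    rw [div_le_iff₀ hden]
    have e : ((2 * xbar : ℕ) : ℝ) = 2 * (xbar : ℝ) := by push_cast; ring
    have e2 : ((N - 0 + 2 : ℕ) : ℝ) = ((N + 2 : ℕ) : ℝ) := by simp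
    rw [e] at hqK; rw [e2]; linarith
  have hB := le_dy_prodUB (hr (N + 1) hNn).2 (hr (N + 1) hNn).1 (hpx (N + 1) le_rfl) U
  simp only [Complex.ofReal_re] at hB
  have hA0 : 0 ≤ canaryR (N + 1) * ((xbar : ℝ) ^ (N + 1) / ((N + 1) ! : ℝ)) := by
    have := canaryR_nonneg (N + 1); positivity
  have hTR0 : canaryTrunc 0 N xbar ≤ dy (2 * prodUB (getFI rb (N + 1)) (getCI px (N + 1)) U) U := by
    unfold canaryTrunc
    simp only [Nat.sub_zero]
    rw [dy_const_mul, show canaryR (N + 1) * (xbar : ℝ) ^ (N + 1) / ((N + 1) ! : ℝ)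
        = canaryR (N + 1) * ((xbar : ℝ) ^ (N + 1) / ((N + 1) ! : ℝ)) by ring]
    push_cast
    exact div_one_sub_le_two_mul hA0 hB hq_le
  have hint := dy_strictMono U hmain
  have hnorm : ‖pieceCentre a 0‖ ≤ (xbar : ℝ) := norm_pieceCentre_le (by simpa using hab)
  unfold AxisIneq
  dsimp only
  exact ⟨hN1, hnorm, lt_of_le_of_lt hq_le (by norm_num), by linarith⟩

end Summit.RiemannHypothesis.RiemannHypothesis.Theorems.JensenPolynomials.LogBand.Canary
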